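import Summits.AtomisticToContinuum.BoseEinsteinCondensation.Theorems.BECGroundStateSOSPeriodicIRBoundFsumDCPotSlot
import Summits.AtomisticToContinuum.BoseEinsteinCondensation.Theorems.BECGroundStateSOSPeriodicIRBoundFsumDCPotPair
import HarnessLib

/-!
# Crux `PeriodicIRBound` (stmt-AtomisticToContinuum-3972), line `fsum-phase-pencil`, stub S3
# `stub_phaseDoubleCommutator` — potential part, E: smoothing bounds of the near lifts against the pair weight

The near lift `A F = liftOp {0, 1} a b c d F = ∑_{j ∈ {0,1}} (|φ_a⟩⟨φ_b|_j − |φ_c⟩⟨φ_d|_j) F` (part A) of a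
continuous `(m+2)`-body `F` is controlled against the pair weight `w^per(x_0 − x_1)` of `pairForm` (part B) by the
mass of `F` alone:

* Bessel, pointwise: `|(|φ_a⟩⟨φ_b|_j F)(X)|² ≤ L⁻³ ∫_cell |F(X[j ↦ y])|² dy` (`|φ_a|² = L⁻³`, Cauchy–Schwarz on the
  cell against the normalised mode `φ_b`), whence `|A F(X)|² ≤ 8 L⁻³ (S₀[F](X) + S₁[F](X))` with the slice squares
  `S_j[F](X) = ∫_cell |F(X[j ↦ y])|² dy`;
* the slice square `S_j[F]` does not see `x_j`, and `∫_{x_j ∈ cell} w^per(x_0 − x_1) = ‖w‖₁` for `j ∈ {0, 1}`, so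
  `∫ w^per(x_0 − x_1) S_j[F] = ‖w‖₁ ‖F‖²` (Tonelli at slot `j`), while `∫ S_j[F] = L³ ‖F‖²`;
* hence `Re pairForm (A F) (A F) = ∫ w^per(x_0 − x_1) |A F|² ≤ 16 ‖w‖₁ L⁻³ ‖F‖²`, `‖A F‖² ≤ 16 ‖F‖²`, and, iterating
  once, `Re pairForm (A' A F) (A' A F) ≤ 256 ‖w‖₁ L⁻³ ‖F‖²` for a second near lift `A'`.

Registered helper stub `stub_fsumDCPotNear`.
-/

noncomputable section

open MeasureTheory Filter
open scoped ENNReal NNReal ComplexConjugate BigOperators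

namespace Summit.AtomisticToContinuum.BoseEinsteinCondensation.Cruxes.PeriodicIRBound.FsumPhasePencil

open Literature.MathematicalPhysics.QuantumManyBody.BoseGas
open Summit.AtomisticToContinuum.BoseEinsteinCondensation.Cruxes.PeriodicIRBound.LinearPhFloorWagner.WF

variable {N m n : ℕ} {L : ℝ}

/-! ## Bessel: the pointwise smoothing bound of a slot lift -/

section Bessel

/-- **Cauchy–Schwarz on the cell against a sub-normalised mode**: if `∫_cell |φ|² ≤ 1` then
`|∫_cell conj(φ) k|² ≤ ∫_cell |k|²` for every a.e.-strongly measurable `k`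
(`|∫ conj(φ) k| ≤ ∫ |φ||k| ≤ ‖φ‖_{L²(cell)} ‖k‖_{L²(cell)}`; no integrability is needed). [folklore] -/
theorem nnnorm_setIntegral_cell_conj_mul_sq_le {φ : Space → ℂ}
    (hφ : AEStronglyMeasurable φ ((volume : Measure Space).restrict (cell L)))
    (hφ1 : ∫⁻ x in cell L, ((‖φ x‖₊ : ℝ≥0∞)) ^ 2 ≤ 1) {k : Space → ℂ}
    (hk : AEStronglyMeasurable k ((volume : Measure Space).restrict (cell L))) :
    ((‖∫ x in cell L, conj (φ x) * k x‖₊ : ℝ≥0∞)) ^ 2 ≤ ∫⁻ x in cell L, ((‖k x‖₊ : ℝ≥0∞)) ^ 2 := by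
  -- the Hölder step follows `nnnorm_setIntegral_conj_mul_sq_le` of the `ModeIdentification` line
  have hφ' : AEMeasurable (fun x => (‖φ x‖₊ : ℝ≥0∞)) (volume.restrict (cell L)) :=
    hφ.aemeasurable.nnnorm.coe_nnreal_ennreal
  have hk' : AEMeasurable (fun x => (‖k x‖₊ : ℝ≥0∞)) (volume.restrict (cell L)) :=
    hk.aemeasurable.nnnorm.coe_nnreal_ennreal
  have hH := ENNReal.lintegral_mul_le_Lp_mul_Lq (volume.restrict (cell L))
    Real.HolderConjugate.two_two hφ' hk'
  simp only [Pi.mul_apply, ENNReal.rpow_two] at hH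
  calc ((‖∫ x in cell L, conj (φ x) * k x‖₊ : ℝ≥0∞)) ^ 2
      ≤ (∫⁻ x in cell L, (‖conj (φ x) * k x‖₊ : ℝ≥0∞)) ^ 2 := by
        gcongr; exact enorm_integral_le_lintegral_enorm _
    _ = (∫⁻ x in cell L, (‖φ x‖₊ : ℝ≥0∞) * (‖k x‖₊ : ℝ≥0∞)) ^ 2 := by
        congr 1
        refine lintegral_congr fun x => ?_
        rw [nnnorm_mul, ENNReal.coe_mul, RCLike.nnnorm_conj]
    _ ≤ ((∫⁻ x in cell L, (‖φ x‖₊ : ℝ≥0∞) ^ 2) ^ (1 / 2 : ℝ) *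
          (∫⁻ x in cell L, (‖k x‖₊ : ℝ≥0∞) ^ 2) ^ (1 / 2 : ℝ)) ^ 2 := by gcongr
    _ ≤ ((1 : ℝ≥0∞) ^ (1 / 2 : ℝ) * (∫⁻ x in cell L, (‖k x‖₊ : ℝ≥0∞) ^ 2) ^ (1 / 2 : ℝ)) ^ 2 := by
        gcongr
    _ = ∫⁻ x in cell L, ((‖k x‖₊ : ℝ≥0∞)) ^ 2 := by
        rw [ENNReal.one_rpow, one_mul, ← ENNReal.rpow_two, ← ENNReal.rpow_mul]
        norm_num

/-- The plane-wave modes are normalised on the cell, in `ℝ≥0∞`: `∫_cell |φ_b|² = L⁻³ · L³ = 1`. [folklore] -/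
theorem lintegral_cell_nnnorm_planeWaveMode_sq (hL : 0 < L) (b : Fin 3 → ℤ) :
    ∫⁻ x in cell L, ((‖planeWaveMode L b x‖₊ : ℝ≥0∞)) ^ 2 = 1 := by
  have hL3 : ENNReal.ofReal L ^ 3 ≠ 0 := pow_ne_zero _ (ENNReal.ofReal_pos.2 hL).ne'
  have hL3' : ENNReal.ofReal L ^ 3 ≠ ⊤ := ENNReal.pow_ne_top ENNReal.ofReal_ne_top
  simp only [nnnorm_planeWaveMode_sq_tk hL]
  rw [setLIntegral_const, volume_cell, ENNReal.inv_mul_cancel hL3 hL3']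

/-- **Bessel (pointwise smoothing bound of a slot lift)**: for continuous `F` and every configuration `X`,
`|(|φ_a⟩⟨φ_b|_j F)(X)|² ≤ L⁻³ ∫_cell |F(X[j ↦ y])|² dy` (`|φ_a(x_j)|² = L⁻³` and Cauchy–Schwarz against the
normalised mode `φ_b`). [folklore] -/
theorem nnnorm_slotLift_sq_le (hL : 0 < L) (j : Fin N) (a b : Fin 3 → ℤ) {F : Config N → ℂ} (hF : Continuous F)
    (X : Config N) :
    ((‖slotLift L j a b F X‖₊ : ℝ≥0∞)) ^ 2 ≤
      (ENNReal.ofReal L ^ 3)⁻¹ * ∫⁻ y in cell L, ((‖F (Function.update X j y)‖₊ : ℝ≥0∞)) ^ 2 := by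
  rw [slotLift_apply, nnnorm_mul, ENNReal.coe_mul, mul_pow, nnnorm_planeWaveMode_sq_tk hL]
  gcongr
  exact nnnorm_setIntegral_cell_conj_mul_sq_le (continuous_planeWaveMode L b).aestronglyMeasurable
    (lintegral_cell_nnnorm_planeWaveMode_sq hL b).le
    (hF.comp (continuous_const.update j continuous_id)).aestronglyMeasurable

/-- The slice square `X ↦ ∫_cell |F(X[j ↦ y])|² dy` of a continuous `F` is measurable (Tonelli). [folklore] -/
theorem measurable_lintegral_cell_sq_update (j : Fin N) {F : Config N → ℂ} (hF : Continuous F) :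
    Measurable fun X : Config N => ∫⁻ y in cell L, ((‖F (Function.update X j y)‖₊ : ℝ≥0∞)) ^ 2 := by
  have h2 : Measurable fun p : Config N × Space => ((‖F (Function.update p.1 j p.2)‖₊ : ℝ≥0∞)) ^ 2 :=
    (hF.comp (continuous_fst.update j continuous_snd)).measurable.nnnorm.coe_nnreal_ennreal.pow_const _
  exact h2.lintegral_prod_right'

end Bessel

/-! ## The near lift, pointwise -/

section Near

/-- `|(z₁ − z₂) + (z₃ − z₄)|² ≤ 4 (|z₁|² + |z₂|²) + 4 (|z₃|² + |z₄|²)` in `ℝ≥0∞`. [folklore] -/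
theorem coe_nnnorm_sub_add_sub_sq_le (z₁ z₂ z₃ z₄ : ℂ) :
    ((‖(z₁ - z₂) + (z₃ - z₄)‖₊ : ℝ≥0∞)) ^ 2 ≤
      4 * (((‖z₁‖₊ : ℝ≥0∞)) ^ 2 + ((‖z₂‖₊ : ℝ≥0∞)) ^ 2) +
        4 * (((‖z₃‖₊ : ℝ≥0∞)) ^ 2 + ((‖z₄‖₊ : ℝ≥0∞)) ^ 2) := by
  have hsub : ∀ u v : ℂ, ((‖u - v‖₊ : ℝ≥0∞)) ^ 2 ≤ 2 * ((‖u‖₊ : ℝ≥0∞)) ^ 2 + 2 * ((‖v‖₊ : ℝ≥0∞)) ^ 2 :=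
    fun u v => by
      have h := coe_nnnorm_add_sq_le u (-v)
      rwa [← sub_eq_add_neg, nnnorm_neg] at h
  calc ((‖(z₁ - z₂) + (z₃ - z₄)‖₊ : ℝ≥0∞)) ^ 2
      ≤ 2 * ((‖z₁ - z₂‖₊ : ℝ≥0∞)) ^ 2 + 2 * ((‖z₃ - z₄‖₊ : ℝ≥0∞)) ^ 2 := coe_nnnorm_add_sq_le _ _
    _ ≤ 2 * (2 * ((‖z₁‖₊ : ℝ≥0∞)) ^ 2 + 2 * ((‖z₂‖₊ : ℝ≥0∞)) ^ 2) +
          2 * (2 * ((‖z₃‖₊ : ℝ≥0∞)) ^ 2 + 2 * ((‖z₄‖₊ : ℝ≥0∞)) ^ 2) := by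
        gcongr
        · exact hsub z₁ z₂
        · exact hsub z₃ z₄
    _ = _ := by ring

/-- The near lift unfolds to its four slot lifts:
`liftOp {0,1} a b c d F = (|φ_a⟩⟨φ_b|_0 − |φ_c⟩⟨φ_d|_0) F + (|φ_a⟩⟨φ_b|_1 − |φ_c⟩⟨φ_d|_1) F`. [folklore] -/
theorem liftOp_pair_apply (a b c d : Fin 3 → ℤ) (F : Config (m + 2) → ℂ) (X : Config (m + 2)) :
    liftOp L ({0, 1} : Finset (Fin (m + 2))) a b c d F X =
      (slotLift L 0 a b F X - slotLift L 0 c d F X) + (slotLift L 1 a b F X - slotLift L 1 c d F X) := by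
  rw [liftOp, Finset.sum_pair Fin.zero_ne_one]

/-- **Pointwise smoothing bound of the near lift**: for continuous `F`,
`|liftOp {0,1} a b c d F (X)|² ≤ 8 L⁻³ (∫_cell |F(X[0 ↦ y])|² dy + ∫_cell |F(X[1 ↦ y])|² dy)`
(four slot lifts, `|∑_{i ≤ 4} zᵢ|² ≤ 4 ∑ |zᵢ|²`, Bessel for each). [folklore] -/
theorem nnnorm_liftOp_pair_sq_le (hL : 0 < L) (a b c d : Fin 3 → ℤ) {F : Config (m + 2) → ℂ} (hF : Continuous F)
    (X : Config (m + 2)) :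
    ((‖liftOp L ({0, 1} : Finset (Fin (m + 2))) a b c d F X‖₊ : ℝ≥0∞)) ^ 2 ≤
      8 * (ENNReal.ofReal L ^ 3)⁻¹ *
        ((∫⁻ y in cell L, ((‖F (Function.update X 0 y)‖₊ : ℝ≥0∞)) ^ 2) +
          ∫⁻ y in cell L, ((‖F (Function.update X 1 y)‖₊ : ℝ≥0∞)) ^ 2) := by
  rw [liftOp_pair_apply]
  have h0ab := nnnorm_slotLift_sq_le hL 0 a b hF X
  have h0cd := nnnorm_slotLift_sq_le hL 0 c d hF X
  have h1ab := nnnorm_slotLift_sq_le hL 1 a b hF X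
  have h1cd := nnnorm_slotLift_sq_le hL 1 c d hF X
  calc ((‖(slotLift L 0 a b F X - slotLift L 0 c d F X) + (slotLift L 1 a b F X - slotLift L 1 c d F X)‖₊ : ℝ≥0∞)) ^ 2
      ≤ 4 * (((‖slotLift L 0 a b F X‖₊ : ℝ≥0∞)) ^ 2 + ((‖slotLift L 0 c d F X‖₊ : ℝ≥0∞)) ^ 2) +
          4 * (((‖slotLift L 1 a b F X‖₊ : ℝ≥0∞)) ^ 2 + ((‖slotLift L 1 c d F X‖₊ : ℝ≥0∞)) ^ 2) :=
        coe_nnnorm_sub_add_sub_sq_le _ _ _ _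
    _ ≤ 4 * ((ENNReal.ofReal L ^ 3)⁻¹ * (∫⁻ y in cell L, ((‖F (Function.update X 0 y)‖₊ : ℝ≥0∞)) ^ 2) +
            (ENNReal.ofReal L ^ 3)⁻¹ * ∫⁻ y in cell L, ((‖F (Function.update X 0 y)‖₊ : ℝ≥0∞)) ^ 2) +
          4 * ((ENNReal.ofReal L ^ 3)⁻¹ * (∫⁻ y in cell L, ((‖F (Function.update X 1 y)‖₊ : ℝ≥0∞)) ^ 2) +
            (ENNReal.ofReal L ^ 3)⁻¹ * ∫⁻ y in cell L, ((‖F (Function.update X 1 y)‖₊ : ℝ≥0∞)) ^ 2) := by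
        gcongr
    _ = _ := by ring

end Near

/-! ## Tonelli at a slot, and the weighted slice squares -/

section Slices

/-- **Tonelli at slot `j`** (`cell^{n+1} ≅ cell × cell^n`, `measurePreserving_piFinSuccAbove_cellN`): for measurable
`K`, `∫_{cell^{n+1}} K = ∫_{Y ∈ cell^n} ∫_{x ∈ cell} K(Z_Y[j ↦ x])`, `Z_Y = insertNth j 0 Y`. [folklore] -/
theorem lintegral_cellN_eq_lintegral_update (j : Fin (n + 1)) (L : ℝ) {K : Config (n + 1) → ℝ≥0∞}
    (hK : Measurable K) :
    ∫⁻ X in cellN (n + 1) L, K X =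
      ∫⁻ Y in cellN n L, ∫⁻ x in cell L, K (Function.update (j.insertNth 0 Y) j x) := by
  have he := (measurePreserving_piFinSuccAbove_cellN (n := n) j L).symm
    (MeasurableEquiv.piFinSuccAbove (fun _ : Fin (n + 1) => Space) j)
  have hes : ∀ p : Space × Config n,
      (MeasurableEquiv.piFinSuccAbove (fun _ : Fin (n + 1) => Space) j).symm p = j.insertNth p.1 p.2 :=
    fun _ => rfl
  have hKm : AEMeasurable (fun p : Space × Config n =>
      K ((MeasurableEquiv.piFinSuccAbove (fun _ : Fin (n + 1) => Space) j).symm p))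
      (((volume : Measure Space).restrict (cell L)).prod ((volume : Measure (Config n)).restrict (cellN n L))) :=
    (hK.comp (MeasurableEquiv.measurable _)).aemeasurable
  rw [← he.lintegral_comp_emb (MeasurableEquiv.measurableEmbedding _) K, lintegral_prod_symm _ hKm]
  simp only [hes, Fin.update_insertNth]

/-- **A slot-blind weight against a slice square**: if `∫_{x ∈ cell} V(Z[j ↦ x]) = I` for every `Z`, then
`∫_{cell^{n+1}} V(X) (∫_cell |F(X[j ↦ y])|² dy) dX = I ‖F‖²` for continuous `F` (the slice square does not see
`x_j`; Tonelli at slot `j` twice). [folklore] -/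
theorem lintegral_mul_lintegral_cell_sq_update (j : Fin (n + 1)) {V : Config (n + 1) → ℝ≥0∞} (hV : Measurable V)
    {I : ℝ≥0∞} (hVI : ∀ Z : Config (n + 1), ∫⁻ x in cell L, V (Function.update Z j x) = I)
    {F : Config (n + 1) → ℂ} (hF : Continuous F) :
    ∫⁻ X in cellN (n + 1) L, V X * ∫⁻ y in cell L, ((‖F (Function.update X j y)‖₊ : ℝ≥0∞)) ^ 2 =
      I * normSq L F := by
  set S : Config (n + 1) → ℝ≥0∞ := fun X => ∫⁻ y in cell L, ((‖F (Function.update X j y)‖₊ : ℝ≥0∞)) ^ 2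
    with hS
  have hFsq : Measurable fun X : Config (n + 1) => ((‖F X‖₊ : ℝ≥0∞)) ^ 2 :=
    hF.measurable.nnnorm.coe_nnreal_ennreal.pow_const _
  have hSm : Measurable S := measurable_lintegral_cell_sq_update j hF
  have hSupd : ∀ (Z : Config (n + 1)) (x : Space), S (Function.update Z j x) = S Z := fun Z x => by
    simp only [hS, Function.update_idem]
  have hins : Measurable fun Y : Config n => S (j.insertNth (0 : Space) Y) :=
    hSm.comp (continuous_const.finInsertNth j continuous_id).measurable
  have hinner : ∀ Y : Config n,
      ∫⁻ x in cell L, V (Function.update (j.insertNth 0 Y) j x) * S (Function.update (j.insertNth 0 Y) j x) =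
        I * S (j.insertNth 0 Y) := fun Y => by
    have hVm : Measurable fun x : Space => V (Function.update (j.insertNth (0 : Space) Y) j x) :=
      hV.comp (measurable_update _)
    simp only [hSupd]
    rw [lintegral_mul_const _ hVm, hVI]
  change ∫⁻ X in cellN (n + 1) L, V X * S X = I * normSq L F
  rw [lintegral_cellN_eq_lintegral_update j L (hV.fun_mul hSm)]
  simp only [hinner]
  rw [lintegral_const_mul _ hins, normSq, lintegral_cellN_eq_lintegral_update j L hFsq]

variable {w : ℝ → ℝ≥0∞}

/-- `∫_{x_0 ∈ cell} w^per(x_0 − x_1) = ‖w‖₁` (the pair weight through slot `0`). [folklore] -/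
theorem lintegral_cell_pairWeight_update_zero (hL : 0 < L) (hw : Measurable w) (Z : Config (m + 2)) :
    ∫⁻ x in cell L, periodizedPotential w L (Function.update Z 0 x 0 - Function.update Z 0 x 1) =
      ∫⁻ z : Space, w ‖z‖ := by
  simp only [Function.update_self, Function.update_of_ne (Fin.zero_ne_one (n := m)).symm]
  exact LinearPhFloorWagner.WF.lintegral_cell_periodizedPotential_sub hL hw (Z 1)

/-- `∫_{x_1 ∈ cell} w^per(x_0 − x_1) = ‖w‖₁` (the pair weight through slot `1`). [folklore] -/
theorem lintegral_cell_pairWeight_update_one (hL : 0 < L) (hw : Measurable w) (Z : Config (m + 2)) :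
    ∫⁻ x in cell L, periodizedPotential w L (Function.update Z 1 x 0 - Function.update Z 1 x 1) =
      ∫⁻ z : Space, w ‖z‖ := by
  simp only [Function.update_self, Function.update_of_ne (Fin.zero_ne_one (n := m))]
  exact lintegral_cell_periodizedPotential_sub' hL hw (Z 0)

/-- `∫ w^per(x_0 − x_1) S₀[F] = ‖w‖₁ ‖F‖²`. [folklore] -/
theorem lintegral_pairWeight_mul_sliceSq_zero (hL : 0 < L) (hw : Measurable w) {F : Config (m + 2) → ℂ}
    (hF : Continuous F) :
    ∫⁻ X in cellN (m + 2) L, periodizedPotential w L (X 0 - X 1) *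
        ∫⁻ y in cell L, ((‖F (Function.update X 0 y)‖₊ : ℝ≥0∞)) ^ 2 =
      (∫⁻ z : Space, w ‖z‖) * normSq L F :=
  lintegral_mul_lintegral_cell_sq_update 0 (measurable_pairWeight hw L)
    (fun Z => lintegral_cell_pairWeight_update_zero hL hw Z) hF

/-- `∫ w^per(x_0 − x_1) S₁[F] = ‖w‖₁ ‖F‖²`. [folklore] -/
theorem lintegral_pairWeight_mul_sliceSq_one (hL : 0 < L) (hw : Measurable w) {F : Config (m + 2) → ℂ}
    (hF : Continuous F) :
    ∫⁻ X in cellN (m + 2) L, periodizedPotential w L (X 0 - X 1) *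
        ∫⁻ y in cell L, ((‖F (Function.update X 1 y)‖₊ : ℝ≥0∞)) ^ 2 =
      (∫⁻ z : Space, w ‖z‖) * normSq L F :=
  lintegral_mul_lintegral_cell_sq_update 1 (measurable_pairWeight hw L)
    (fun Z => lintegral_cell_pairWeight_update_one hL hw Z) hF

end Slices

/-! ## The smoothing bounds in `ℝ≥0∞` -/

section Smoothing

variable {w : ℝ → ℝ≥0∞}

/-- **The near lift against the pair weight**, in `ℝ≥0∞`: for continuous `F`,
`∫ w^per(x_0 − x_1) |liftOp {0,1} a b c d F|² ≤ 16 · L⁻³ ‖w‖₁ ‖F‖²`. [folklore] -/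
theorem lintegral_pairWeight_liftOp_pair_sq_le (hL : 0 < L) (hw : Measurable w) (a b c d : Fin 3 → ℤ)
    {F : Config (m + 2) → ℂ} (hF : Continuous F) :
    ∫⁻ X in cellN (m + 2) L, periodizedPotential w L (X 0 - X 1) *
        ((‖liftOp L ({0, 1} : Finset (Fin (m + 2))) a b c d F X‖₊ : ℝ≥0∞)) ^ 2 ≤
      16 * ((ENNReal.ofReal L ^ 3)⁻¹ * (∫⁻ z : Space, w ‖z‖) * normSq L F) := by
  have hS0 := measurable_lintegral_cell_sq_update (L := L) (0 : Fin (m + 2)) hF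
  have hS1 := measurable_lintegral_cell_sq_update (L := L) (1 : Fin (m + 2)) hF
  have hW : Measurable fun X : Config (m + 2) => periodizedPotential w L (X 0 - X 1) := measurable_pairWeight hw L
  have hpt : ∀ X : Config (m + 2), periodizedPotential w L (X 0 - X 1) *
      ((‖liftOp L ({0, 1} : Finset (Fin (m + 2))) a b c d F X‖₊ : ℝ≥0∞)) ^ 2 ≤
      8 * (ENNReal.ofReal L ^ 3)⁻¹ *
        (periodizedPotential w L (X 0 - X 1) * (∫⁻ y in cell L, ((‖F (Function.update X 0 y)‖₊ : ℝ≥0∞)) ^ 2) +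
          periodizedPotential w L (X 0 - X 1) * ∫⁻ y in cell L, ((‖F (Function.update X 1 y)‖₊ : ℝ≥0∞)) ^ 2) :=
    fun X => by
      calc _ ≤ periodizedPotential w L (X 0 - X 1) * (8 * (ENNReal.ofReal L ^ 3)⁻¹ *
            ((∫⁻ y in cell L, ((‖F (Function.update X 0 y)‖₊ : ℝ≥0∞)) ^ 2) +
              ∫⁻ y in cell L, ((‖F (Function.update X 1 y)‖₊ : ℝ≥0∞)) ^ 2)) :=
          mul_le_mul_right (nnnorm_liftOp_pair_sq_le hL a b c d hF X) _
        _ = _ := by ring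
  calc _ ≤ ∫⁻ X in cellN (m + 2) L, 8 * (ENNReal.ofReal L ^ 3)⁻¹ *
        (periodizedPotential w L (X 0 - X 1) * (∫⁻ y in cell L, ((‖F (Function.update X 0 y)‖₊ : ℝ≥0∞)) ^ 2) +
          periodizedPotential w L (X 0 - X 1) * ∫⁻ y in cell L, ((‖F (Function.update X 1 y)‖₊ : ℝ≥0∞)) ^ 2) :=
        lintegral_mono hpt
    _ = 8 * (ENNReal.ofReal L ^ 3)⁻¹ * ((∫⁻ z : Space, w ‖z‖) * normSq L F + (∫⁻ z : Space, w ‖z‖) * normSq L F) := by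
        rw [lintegral_const_mul _ ((hW.fun_mul hS0).fun_add (hW.fun_mul hS1)), lintegral_add_left (hW.fun_mul hS0),
          lintegral_pairWeight_mul_sliceSq_zero hL hw hF, lintegral_pairWeight_mul_sliceSq_one hL hw hF]
    _ = _ := by ring

/-- **The near lift is bounded**: `‖liftOp {0,1} a b c d F‖² ≤ 16 ‖F‖²` for continuous `F`
(`∫ S_j[F] = L³ ‖F‖²`, `lintegral_cellN_lintegral_update`). [folklore] -/
theorem normSq_liftOp_pair_le (hL : 0 < L) (a b c d : Fin 3 → ℤ) {F : Config (m + 2) → ℂ} (hF : Continuous F) :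
    normSq L (liftOp L ({0, 1} : Finset (Fin (m + 2))) a b c d F) ≤ 16 * normSq L F := by
  have hL3 : ENNReal.ofReal L ^ 3 ≠ 0 := pow_ne_zero _ (ENNReal.ofReal_pos.2 hL).ne'
  have hL3' : ENNReal.ofReal L ^ 3 ≠ ⊤ := ENNReal.pow_ne_top ENNReal.ofReal_ne_top
  have hS0 := measurable_lintegral_cell_sq_update (L := L) (0 : Fin (m + 2)) hF
  have hS1 := measurable_lintegral_cell_sq_update (L := L) (1 : Fin (m + 2)) hF
  have hFsq : Measurable fun X : Config (m + 2) => ((‖F X‖₊ : ℝ≥0∞)) ^ 2 :=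
    hF.measurable.nnnorm.coe_nnreal_ennreal.pow_const _
  unfold normSq
  calc ∫⁻ X in cellN (m + 2) L, ((‖liftOp L ({0, 1} : Finset (Fin (m + 2))) a b c d F X‖₊ : ℝ≥0∞)) ^ 2
      ≤ ∫⁻ X in cellN (m + 2) L, 8 * (ENNReal.ofReal L ^ 3)⁻¹ *
          ((∫⁻ y in cell L, ((‖F (Function.update X 0 y)‖₊ : ℝ≥0∞)) ^ 2) +
            ∫⁻ y in cell L, ((‖F (Function.update X 1 y)‖₊ : ℝ≥0∞)) ^ 2) :=
        lintegral_mono fun X => nnnorm_liftOp_pair_sq_le hL a b c d hF X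
    _ = 8 * (ENNReal.ofReal L ^ 3)⁻¹ * (ENNReal.ofReal L ^ 3 * (∫⁻ X in cellN (m + 2) L, ((‖F X‖₊ : ℝ≥0∞)) ^ 2) +
          ENNReal.ofReal L ^ 3 * ∫⁻ X in cellN (m + 2) L, ((‖F X‖₊ : ℝ≥0∞)) ^ 2) := by
        rw [lintegral_const_mul _ (hS0.fun_add hS1), lintegral_add_left hS0, lintegral_cellN_lintegral_update 0 hFsq,
          lintegral_cellN_lintegral_update 1 hFsq]
    _ = 16 * ((ENNReal.ofReal L ^ 3)⁻¹ * ENNReal.ofReal L ^ 3) *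
          ∫⁻ X in cellN (m + 2) L, ((‖F X‖₊ : ℝ≥0∞)) ^ 2 := by ring
    _ = 16 * ∫⁻ X in cellN (m + 2) L, ((‖F X‖₊ : ℝ≥0∞)) ^ 2 := by
        rw [ENNReal.inv_mul_cancel hL3 hL3', mul_one]

end Smoothing

/-! ## The smoothing bounds for the pair form -/

section PairForm

variable {w : ℝ → ℝ≥0∞} (hL : 0 < L) (hw : Measurable w) (hint : (∫⁻ z : Space, w ‖z‖) ≠ ⊤)
include hL hw hint

/-- Reading an `ℝ≥0∞` bound of the weighted square integral as a bound of `Re pairForm H H`. [folklore] -/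
theorem pairForm_self_re_le_toReal {H : Config (m + 2) → ℂ} (hH : Continuous H) {B : ℝ≥0∞} (hB : B ≠ ⊤)
    (hle : ∫⁻ X in cellN (m + 2) L, periodizedPotential w L (X 0 - X 1) * ((‖H X‖₊ : ℝ≥0∞)) ^ 2 ≤ B) :
    (pairForm w L H H).re ≤ B.toReal := by
  rw [pairForm_self_re hL hw hint hH]
  exact ENNReal.toReal_mono hB hle

omit hw hint in
/-- `(C · (L⁻³ ‖w‖₁ ‖F‖²)).toReal = C (‖w‖₁/L³) ‖F‖²`. [folklore] -/
theorem toReal_const_mul_smoothing (C : ℕ) [C.AtLeastTwo] (F : Config (m + 2) → ℂ) :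
    ((OfNat.ofNat C : ℝ≥0∞) * ((ENNReal.ofReal L ^ 3)⁻¹ * (∫⁻ z : Space, w ‖z‖) * normSq L F)).toReal =
      (OfNat.ofNat C : ℝ) * ((∫⁻ z : Space, w ‖z‖).toReal / L ^ 3) * (normSq L F).toReal := by
  simp only [ENNReal.toReal_mul, ENNReal.toReal_ofNat, ENNReal.toReal_inv, ENNReal.toReal_pow,
    ENNReal.toReal_ofReal hL.le]
  ring

omit hw in
/-- The bound `C · (L⁻³ ‖w‖₁ ‖F‖²)` is finite for continuous `F`. [folklore] -/
theorem const_mul_smoothing_ne_top (C : ℕ) [C.AtLeastTwo] {F : Config (m + 2) → ℂ} (hF : Continuous F) :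
    (OfNat.ofNat C : ℝ≥0∞) * ((ENNReal.ofReal L ^ 3)⁻¹ * (∫⁻ z : Space, w ‖z‖) * normSq L F) ≠ ⊤ := by
  have hc : (ENNReal.ofReal L ^ 3)⁻¹ ≠ ⊤ := ENNReal.inv_ne_top.2 (pow_ne_zero _ (ENNReal.ofReal_pos.2 hL).ne')
  exact ENNReal.mul_ne_top (ENNReal.ofNat_ne_top)
    (ENNReal.mul_ne_top (ENNReal.mul_ne_top hc hint) (normSq_ne_top L hF))

/-- **Smoothing bound of the near lift** (clause 1): for continuous `F`,
`Re pairForm (A F) (A F) ≤ 16 (‖w‖₁/L³) ‖F‖²`, `A = liftOp {0,1} a b c d`. [folklore] -/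
theorem pairForm_liftOp_pair_self_re_le (a b c d : Fin 3 → ℤ) {F : Config (m + 2) → ℂ} (hF : Continuous F) :
    (pairForm w L (liftOp L ({0, 1} : Finset (Fin (m + 2))) a b c d F)
        (liftOp L ({0, 1} : Finset (Fin (m + 2))) a b c d F)).re ≤
      16 * ((∫⁻ z : Space, w ‖z‖).toReal / L ^ 3) * (normSq L F).toReal := by
  rw [← toReal_const_mul_smoothing hL 16 F]
  exact pairForm_self_re_le_toReal hL hw hint (continuous_liftOp L _ a b c d hF)
    (const_mul_smoothing_ne_top hL hint 16 hF) (lintegral_pairWeight_liftOp_pair_sq_le hL hw a b c d hF)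

/-- **Smoothing bound of the iterated near lift** (clause 2): for continuous `F`,
`Re pairForm (A' A F) (A' A F) ≤ 256 (‖w‖₁/L³) ‖F‖²`, `A = liftOp {0,1} a b c d`, `A' = liftOp {0,1} a' b' c' d'`
(clause 1 in `ℝ≥0∞` for `A F`, and `‖A F‖² ≤ 16 ‖F‖²`). [folklore] -/
theorem pairForm_liftOp_pair_liftOp_pair_self_re_le (a b c d a' b' c' d' : Fin 3 → ℤ) {F : Config (m + 2) → ℂ}
    (hF : Continuous F) :
    (pairForm w L
        (liftOp L ({0, 1} : Finset (Fin (m + 2))) a' b' c' d' (liftOp L ({0, 1} : Finset (Fin (m + 2))) a b c d F))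
        (liftOp L ({0, 1} : Finset (Fin (m + 2))) a' b' c' d' (liftOp L ({0, 1} : Finset (Fin (m + 2))) a b c d F))).re ≤
      256 * ((∫⁻ z : Space, w ‖z‖).toReal / L ^ 3) * (normSq L F).toReal := by
  have hG : Continuous (liftOp L ({0, 1} : Finset (Fin (m + 2))) a b c d F) := continuous_liftOp L _ a b c d hF
  have hle : ∫⁻ X in cellN (m + 2) L, periodizedPotential w L (X 0 - X 1) *
      ((‖liftOp L ({0, 1} : Finset (Fin (m + 2))) a' b' c' d'
        (liftOp L ({0, 1} : Finset (Fin (m + 2))) a b c d F) X‖₊ : ℝ≥0∞)) ^ 2 ≤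
      256 * ((ENNReal.ofReal L ^ 3)⁻¹ * (∫⁻ z : Space, w ‖z‖) * normSq L F) :=
    calc _ ≤ 16 * ((ENNReal.ofReal L ^ 3)⁻¹ * (∫⁻ z : Space, w ‖z‖) *
          normSq L (liftOp L ({0, 1} : Finset (Fin (m + 2))) a b c d F)) :=
        lintegral_pairWeight_liftOp_pair_sq_le hL hw a' b' c' d' hG
      _ ≤ 16 * ((ENNReal.ofReal L ^ 3)⁻¹ * (∫⁻ z : Space, w ‖z‖) * (16 * normSq L F)) := by
        gcongr
        exact normSq_liftOp_pair_le hL a b c d hF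
      _ = _ := by ring
  rw [← toReal_const_mul_smoothing hL 256 F]
  exact pairForm_self_re_le_toReal hL hw hint (continuous_liftOp L _ a' b' c' d' hG)
    (const_mul_smoothing_ne_top hL hint 256 hF) hle

end PairForm

/-! ## Registered headline -/

/-- **Registered helper stub `stub_fsumDCPotNear`** (line `fsum-phase-pencil`, S3 potential part E): the smoothing
bounds of the near lifts against the pair weight, `pairForm_liftOp_pair_self_re_le` and
`pairForm_liftOp_pair_liftOp_pair_self_re_le`. [folklore] -/
theorem stub_fsumDCPotNear : ∀ {m : ℕ} {L : ℝ} {w : ℝ → ℝ≥0∞}, 0 < L → Measurable w → (∫⁻ z : Space, w ‖z‖) ≠ ⊤ → ∀ (a b c d a' b' c' d' : Fin 3 → ℤ) {F : Config (m + 2) → ℂ}, Continuous F → (pairForm w L (liftOp L ({0, 1} : Finset (Fin (m + 2))) a b c d F) (liftOp L ({0, 1} : Finset (Fin (m + 2))) a b c d F)).re ≤ 16 * ((∫⁻ z : Space, w ‖z‖).toReal / L ^ 3) * (normSq L F).toReal ∧ (pairForm w L (liftOp L ({0, 1} : Finset (Fin (m + 2))) a' b' c' d' (liftOp L ({0, 1}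 : Finset (Fin (m + 2))) a b c d F)) (liftOp L ({0, 1} : Finset (Fin (m + 2))) a' b' c' d' (liftOp L ({0, 1} : Finset (Fin (m + 2))) a b c d F))).re ≤ 256 * ((∫⁻ z : Space, w ‖z‖).toReal / L ^ 3) * (normSq L F).toReal :=
  fun hL hw hint a b c d a' b' c' d' _ hF =>
    ⟨pairForm_liftOp_pair_self_re_le hL hw hint a b c d hF,
      pairForm_liftOp_pair_liftOp_pair_self_re_le hL hw hint a b c d a' b' c' d' hF⟩

end Summit.AtomisticToContinuum.BoseEinsteinCondensation.Cruxes.PeriodicIRBound.FsumPhasePencil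

end
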